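import Literature.NumberTheory.Automorphic.ArtinLFunctionsBrauerHolds
import Literature.RepresentationTheory.FiniteGroups.IrreducibleCharacters
import HarnessLib

/-!
# Heilbronn's formalism, I: the order of vanishing attached to a realised character

Topic `Literature/NumberTheory/LFunctions`, grouping namespace
`Literature.NumberTheory.LFunctions.Heilbronn` (after H. Heilbronn, whose "generalized character"
`θ = Σ_χ n(χ) χ` — Murty–Murty, *Non-vanishing of `L`-functions and applications*, Ch. 2 §5 —
is built in the sequel files from the integers defined here). Everything in this file is PROVED;
the only definition is `Heilbronn.artinOrder` (a genuine `ℤ`-valued function, no named fact).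

The `L`-function formalism of [MurtyMurty1997, Ch. 2 §5] attaches to every character `ψ` of a
Galois group a number `n(ψ)` = the order of the zero at `s = s₀` of the Artin `L`-series of `ψ`,
additive in `ψ` (property (1) there). Here, for a number field `K`, a point `s₀ ∈ ℂ` and a
function `f : Γ_K → ℂ` REALISED by an Artin representation `τ` (the tree's
`Automorphic.HasArtinRealization f L`: `χ_τ = f`, `L(s, τ) = L(s)` on `re s > 1`), we define

* `Heilbronn.artinOrder s₀ f : ℤ` — the order at `s₀` of the meromorphic continuation of
  `L(s, τ)` to `ℂ` (which exists by the Artin–Brauer theorem, PROVED in the tree: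
  `Automorphic.artinLFunction_hasMeromorphicContinuation`), and `0` if `f` is not realised;

and prove that it is well defined and additive:

* `meromorphicOrderAt_eq_of_eqOn_one_lt_re` — two meromorphic functions on `ℂ` that agree on
  `re s > 1` have the same order everywhere (identity principle);
* `artinOrder_eq_meromorphicOrderAt` — `artinOrder s₀ f` is the order at `s₀` of ANY meromorphic
  `g` on `ℂ` continuing ANY `L` realising `f` (the `L`-series depends only on the character,
  `HasArtinRealization.apply_eq`, and is non-zero on `re s > 1`, so `g` has finite order);
* `artinOrder_add`, `artinOrder_zero`, `artinOrder_nsmul`, `artinOrder_sum` — additivity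
  (property (1) of [MurtyMurty1997, Ch. 2 §5]), from `L(s, τ ⊕ τ') = L(s, τ) L(s, τ')`;
* `artinOrder_nonneg_of_hasEntireContinuation` — if the realising `L` has an entire continuation
  then `artinOrder s₀ f ≥ 0`.

## References

* M. R. Murty, V. K. Murty, *Non-vanishing of `L`-functions and applications*, Birkhäuser 1997,
  Ch. 2 §5 (the formalism `n(H, ψ)`, properties (1)–(2)). [MurtyMurty1997]
* H. M. Stark, *Some effective cases of the Brauer–Siegel theorem*, Invent. Math. 23 (1974)
  135–152, §3. [Stark1974]
-/

noncomputable section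

open Filter Complex Set
open scoped Topology

namespace Literature.NumberTheory.LFunctions

namespace Heilbronn

open Literature.NumberTheory.GaloisRepresentations Literature.NumberTheory.Automorphic

universe u

variable {K : Type u} [Field K] [NumberField K]

/-! ### Meromorphic continuations from `re s > 1`: uniqueness of orders -/

/-- A meromorphic function on `ℂ` vanishing on `re s > 1` has order `⊤` everywhere. [folklore] -/
theorem meromorphicOrderAt_eq_top_of_eqOn_zero {h : ℂ → ℂ} (hh : Meromorphic h)
    (h0 : ∀ s : ℂ, 1 < s.re → h s = 0) (z : ℂ) : meromorphicOrderAt h z = ⊤ := by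
  have h2 : meromorphicOrderAt h 2 = ⊤ := by
    rw [meromorphicOrderAt_eq_top_iff]
    have hmem : {s : ℂ | 1 < s.re} ∈ 𝓝[≠] (2 : ℂ) :=
      mem_nhdsWithin_of_mem_nhds ((isOpen_lt continuous_const Complex.continuous_re).mem_nhds (by simp))
    filter_upwards [hmem] with s hs using h0 s hs
  by_contra hz
  have hon : MeromorphicOn h Set.univ := fun x _ => hh x
  exact (hon.meromorphicOrderAt_ne_top_of_isPreconnected isPreconnected_univ (Set.mem_univ z)
    (Set.mem_univ 2) hz) h2

/-- **Two meromorphic continuations have the same orders**: meromorphic `g₁, g₂ : ℂ → ℂ` agreeing on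
`re s > 1` have equal order at every point (identity principle on the connected plane).
[folklore] -/
theorem meromorphicOrderAt_eq_of_eqOn_one_lt_re {g₁ g₂ : ℂ → ℂ} (h₁ : Meromorphic g₁)
    (h₂ : Meromorphic g₂) (h : ∀ s : ℂ, 1 < s.re → g₁ s = g₂ s) (z : ℂ) :
    meromorphicOrderAt g₁ z = meromorphicOrderAt g₂ z := by
  have htop := meromorphicOrderAt_eq_top_of_eqOn_zero (h := g₁ - g₂) (fun x => (h₁ x).sub (h₂ x))
    (fun s hs => by simp [h s hs]) z
  rw [meromorphicOrderAt_eq_top_iff] at htop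
  refine meromorphicOrderAt_congr ?_
  filter_upwards [htop] with w hw
  simpa [sub_eq_zero] using hw

/-- A meromorphic `g : ℂ → ℂ` which is non-zero on `re s > 1` has finite order everywhere.
[folklore] -/
theorem meromorphicOrderAt_ne_top_of_ne_zero {g : ℂ → ℂ} (hg : Meromorphic g)
    (hne : ∀ s : ℂ, 1 < s.re → g s ≠ 0) (z : ℂ) : meromorphicOrderAt g z ≠ ⊤ := by
  have h2 : meromorphicOrderAt g 2 ≠ ⊤ := by
    rw [meromorphicOrderAt_ne_top_iff_eventually_ne_zero (hg 2)]
    have hmem : {s : ℂ | 1 < s.re} ∈ 𝓝[≠] (2 : ℂ) :=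
      mem_nhdsWithin_of_mem_nhds ((isOpen_lt continuous_const Complex.continuous_re).mem_nhds (by simp))
    filter_upwards [hmem] with s hs using hne s hs
  have hon : MeromorphicOn g Set.univ := fun x _ => hg x
  exact hon.meromorphicOrderAt_ne_top_of_isPreconnected isPreconnected_univ (Set.mem_univ 2)
    (Set.mem_univ z) h2

/-! ### Realised functions: continuations exist and are non-zero on `re s > 1` -/

/-- A realised pair `(f, L)` has `L(s) ≠ 0` for `re s > 1` (Artin `L`-functions do not vanish
there, `artinLFunction_ne_zero_holds`). [cite: NeukirchANT1999, VII §10, remark after (10.1)] -/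
theorem _root_.Literature.NumberTheory.Automorphic.HasArtinRealization.ne_zero
    {f : Field.absoluteGaloisGroup K → ℂ} {L : ℂ → ℂ} (h : HasArtinRealization f L) {s : ℂ}
    (hs : 1 < s.re) : L s ≠ 0 := by
  obtain ⟨V, _, _, _, _, _, τ, -, hL⟩ := h
  rw [← hL s hs]
  exact artinLFunction_ne_zero_holds (V := V) τ s hs

/-- A realised pair `(f, L)` has a meromorphic continuation of `L` to `ℂ` (Artin–Brauer,
`artinLFunction_hasMeromorphicContinuation`). [cite: Brauer1947, Thm. 1] -/
theorem _root_.Literature.NumberTheory.Automorphic.HasArtinRealization.exists_meromorphic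
    {f : Field.absoluteGaloisGroup K → ℂ} {L : ℂ → ℂ} (h : HasArtinRealization f L) :
    ∃ g : ℂ → ℂ, Meromorphic g ∧ ∀ s : ℂ, 1 < s.re → g s = L s := by
  obtain ⟨V, _, _, _, _, _, τ, -, hL⟩ := h
  obtain ⟨g, hg, hgL⟩ := artinLFunction_hasMeromorphicContinuation τ
  exact ⟨g, hg, fun s hs => (hgL s hs).trans (hL s hs)⟩

/-- Any meromorphic continuation of a realised `L` has finite order everywhere. [folklore] -/
theorem _root_.Literature.NumberTheory.Automorphic.HasArtinRealization.meromorphicOrderAt_ne_top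
    {f : Field.absoluteGaloisGroup K → ℂ} {L : ℂ → ℂ} (h : HasArtinRealization f L) {g : ℂ → ℂ}
    (hg : Meromorphic g) (hgL : ∀ s : ℂ, 1 < s.re → g s = L s) (z : ℂ) :
    meromorphicOrderAt g z ≠ ⊤ :=
  meromorphicOrderAt_ne_top_of_ne_zero hg (fun s hs => by rw [hgL s hs]; exact h.ne_zero hs) z

/-- Two realisations of the same `f`, continued meromorphically, have the same orders
(`HasArtinRealization.apply_eq` + `meromorphicOrderAt_eq_of_eqOn_one_lt_re`). [folklore] -/
theorem _root_.Literature.NumberTheory.Automorphic.HasArtinRealization.meromorphicOrderAt_eq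
    {f : Field.absoluteGaloisGroup K → ℂ} {L L' : ℂ → ℂ} (h : HasArtinRealization f L)
    (h' : HasArtinRealization f L') {g g' : ℂ → ℂ} (hg : Meromorphic g)
    (hgL : ∀ s : ℂ, 1 < s.re → g s = L s) (hg' : Meromorphic g')
    (hgL' : ∀ s : ℂ, 1 < s.re → g' s = L' s) (z : ℂ) :
    meromorphicOrderAt g z = meromorphicOrderAt g' z :=
  meromorphicOrderAt_eq_of_eqOn_one_lt_re hg hg'
    (fun s hs => by rw [hgL s hs, hgL' s hs, h.apply_eq h' hs]) z

/-! ### The order functional -/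

/-- **The order of vanishing at `s₀` attached to a realised function** `f : Γ_K → ℂ`
([MurtyMurty1997, Ch. 2 §5]: "`n(H, ψ)` is the order of the zero at `s = s₀` of the Artin
`L`-series attached to `ψ`"): if `f` is realised by an Artin representation (`HasArtinRealization
f L` for some `L`), the order at `s₀` of a meromorphic continuation of `L` to `ℂ` — independent of
all choices (`artinOrder_eq_meromorphicOrderAt`); otherwise the junk value `0`.
[cite: MurtyMurty1997, Ch. 2 §5] -/
def artinOrder (s₀ : ℂ) (f : Field.absoluteGaloisGroup K → ℂ) : ℤ :=
  open scoped Classical in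
  if h : ∃ L : ℂ → ℂ, HasArtinRealization f L then
    (meromorphicOrderAt h.choose_spec.exists_meromorphic.choose s₀).untopD 0
  else 0

/-- **`artinOrder` is the order of any meromorphic continuation of any realising `L`.**
[cite: MurtyMurty1997, Ch. 2 §5] -/
theorem artinOrder_eq_meromorphicOrderAt {s₀ : ℂ} {f : Field.absoluteGaloisGroup K → ℂ}
    {L : ℂ → ℂ} (h : HasArtinRealization f L) {g : ℂ → ℂ} (hg : Meromorphic g)
    (hgL : ∀ s : ℂ, 1 < s.re → g s = L s) :
    (artinOrder s₀ f : WithTop ℤ) = meromorphicOrderAt g s₀ := by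
  classical
  have hex : ∃ L : ℂ → ℂ, HasArtinRealization f L := ⟨L, h⟩
  rw [artinOrder, dif_pos hex]
  set g₀ := hex.choose_spec.exists_meromorphic.choose with hg₀def
  have hg₀ : Meromorphic g₀ ∧ ∀ s : ℂ, 1 < s.re → g₀ s = hex.choose s :=
    hex.choose_spec.exists_meromorphic.choose_spec
  have heq : meromorphicOrderAt g₀ s₀ = meromorphicOrderAt g s₀ :=
    hex.choose_spec.meromorphicOrderAt_eq h hg₀.1 hg₀.2 hg hgL s₀
  obtain ⟨n, hn⟩ := WithTop.ne_top_iff_exists.mp (h.meromorphicOrderAt_ne_top hg hgL s₀)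
  rw [heq, ← hn, WithTop.untopD_coe]

/-- Unrealised functions get the junk value `0`. [folklore] -/
theorem artinOrder_of_not_exists {s₀ : ℂ} {f : Field.absoluteGaloisGroup K → ℂ}
    (h : ¬ ∃ L : ℂ → ℂ, HasArtinRealization f L) : artinOrder s₀ f = 0 := by
  classical
  rw [artinOrder, dif_neg h]

/-- **Additivity** ([MurtyMurty1997, Ch. 2 §5, property (1)]): for realised `f`, `f'`,
`artinOrder s₀ (f + f') = artinOrder s₀ f + artinOrder s₀ f'` — the product of continuations
continues `L · L'`, which realises `f + f'` (`HasArtinRealization.mul`).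
[cite: MurtyMurty1997, Ch. 2 §5] -/
theorem artinOrder_add {s₀ : ℂ} {f f' : Field.absoluteGaloisGroup K → ℂ} {L L' : ℂ → ℂ}
    (h : HasArtinRealization f L) (h' : HasArtinRealization f' L') :
    artinOrder s₀ (f + f') = artinOrder s₀ f + artinOrder s₀ f' := by
  obtain ⟨g, hg, hgL⟩ := h.exists_meromorphic
  obtain ⟨g', hg', hgL'⟩ := h'.exists_meromorphic
  have hsum := artinOrder_eq_meromorphicOrderAt (s₀ := s₀) (h.mul h') (g := g * g')
    (fun x => (hg x).mul (hg' x)) (fun s hs => by simp [hgL s hs, hgL' s hs])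
  rw [meromorphicOrderAt_mul (hg s₀) (hg' s₀), ← artinOrder_eq_meromorphicOrderAt h hg hgL,
    ← artinOrder_eq_meromorphicOrderAt h' hg' hgL', ← WithTop.coe_add] at hsum
  exact_mod_cast hsum

/-- `artinOrder s₀ 0 = 0` (the zero representation has `L = 1`). [folklore] -/
theorem artinOrder_zero (s₀ : ℂ) : artinOrder s₀ (0 : Field.absoluteGaloisGroup K → ℂ) = 0 := by
  have h := artinOrder_eq_meromorphicOrderAt (s₀ := s₀) (HasArtinRealization.one (K := K))
    (g := fun _ => (1 : ℂ)) (fun x => MeromorphicAt.const 1 x) (fun s _ => rfl)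
  have h1 : meromorphicOrderAt (fun _ : ℂ => (1 : ℂ)) s₀ = 0 := by
    rw [meromorphicOrderAt_const]; simp
  rw [h1] at h
  exact_mod_cast h

/-- `artinOrder s₀ (m • f) = m • artinOrder s₀ f` for realised `f`. [folklore] -/
theorem artinOrder_nsmul {s₀ : ℂ} {f : Field.absoluteGaloisGroup K → ℂ} {L : ℂ → ℂ}
    (h : HasArtinRealization f L) (m : ℕ) :
    artinOrder s₀ (m • f) = m • artinOrder s₀ f := by
  induction m with
  | zero => rw [zero_nsmul, zero_nsmul]; exact artinOrder_zero s₀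
  | succ m ih => rw [succ_nsmul, succ_nsmul, artinOrder_add (h.nsmul m) h, ih]

/-- **Additivity over finite sums** of realised functions with multiplicities. [cite: MurtyMurty1997, Ch. 2 §5] -/
theorem artinOrder_sum {s₀ : ℂ} {ι : Type*} (S : Finset ι)
    {f : ι → Field.absoluteGaloisGroup K → ℂ} {L : ι → ℂ → ℂ} (m : ι → ℕ)
    (h : ∀ i ∈ S, HasArtinRealization (f i) (L i)) :
    artinOrder s₀ (∑ i ∈ S, m i • f i) = ∑ i ∈ S, m i • artinOrder s₀ (f i) := by
  classical
  induction S using Finset.induction_on with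
  | empty => rw [Finset.sum_empty, Finset.sum_empty]; exact artinOrder_zero s₀
  | insert a S ha ih =>
    rw [Finset.sum_insert ha, Finset.sum_insert ha,
      artinOrder_add ((h a (Finset.mem_insert_self a S)).nsmul (m a))
        (HasArtinRealization.sum S m fun i hi => h i (Finset.mem_insert_of_mem hi)),
      artinOrder_nsmul (h a (Finset.mem_insert_self a S)),
      ih fun i hi => h i (Finset.mem_insert_of_mem hi)]

/-- **Non-negativity for entire `L`**: if a realising `L` has an entire continuation, then
`artinOrder s₀ f ≥ 0` (an analytic function has non-negative order). [folklore] -/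
theorem artinOrder_nonneg_of_hasEntireContinuation {s₀ : ℂ} {f : Field.absoluteGaloisGroup K → ℂ}
    {L : ℂ → ℂ} (h : HasArtinRealization f L) (hL : LFunction.HasEntireContinuation L) :
    0 ≤ artinOrder s₀ f := by
  obtain ⟨g, hg, hgL⟩ := hL
  have heq := artinOrder_eq_meromorphicOrderAt (s₀ := s₀) h
    (fun x => (hg.analyticAt x).meromorphicAt) hgL
  have hnn := (hg.analyticAt s₀).meromorphicOrderAt_nonneg
  rw [← heq] at hnn
  exact_mod_cast hnn

/-- **Vanishing iff positive order**: for a realised `f` with a continuation `g` ANALYTIC at `s₀`,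
`g s₀ = 0 ↔ 0 < artinOrder s₀ f`. [folklore] -/
theorem artinOrder_pos_iff {s₀ : ℂ} {f : Field.absoluteGaloisGroup K → ℂ} {L : ℂ → ℂ}
    (h : HasArtinRealization f L) {g : ℂ → ℂ} (hg : Meromorphic g)
    (hgL : ∀ s : ℂ, 1 < s.re → g s = L s) (han : AnalyticAt ℂ g s₀) :
    0 < artinOrder s₀ f ↔ g s₀ = 0 := by
  have heq := artinOrder_eq_meromorphicOrderAt (s₀ := s₀) h hg hgL
  have hne := h.meromorphicOrderAt_ne_top hg hgL s₀
  rw [han.meromorphicOrderAt_eq] at heq hne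
  have hne' : analyticOrderAt g s₀ ≠ ⊤ := fun htop => hne (by simp [htop])
  constructor
  · intro hpos
    by_contra hg0
    have h0 : analyticOrderAt g s₀ = 0 := han.analyticOrderAt_eq_zero.mpr hg0
    rw [h0] at heq
    have : (artinOrder s₀ f : WithTop ℤ) = 0 := by simpa using heq
    have : artinOrder s₀ f = 0 := by exact_mod_cast this
    omega
  · intro hg0
    have hpos : 0 < analyticOrderAt g s₀ := pos_iff_ne_zero.mpr (han.analyticOrderAt_ne_zero.mpr hg0)
    obtain ⟨n, hn⟩ := ENat.ne_top_iff_exists.mp hne'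
    rw [← hn] at heq hpos
    have hn0 : 0 < n := by exact_mod_cast hpos
    have : (artinOrder s₀ f : WithTop ℤ) = (n : ℤ) := by
      rw [heq]; simp [ENat.map_coe]
    have : artinOrder s₀ f = n := by exact_mod_cast this
    omega

/-! ### Finite Galois quotients: inflation and the Heilbronn character -/

section Quotient

open Literature.RepresentationTheory.FiniteGroups

variable {F : Type} [Field F] {G : Type} [Group G] {q : Field.absoluteGaloisGroup F →* G}

/-- **Inflation** of a representation `τ` of the finite Galois group `G` (exhibited by
`q : Γ_F → G`, `IsArtinQuotient q`) to the Artin representation `τ ∘ q` of `Γ_F` on the same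
space (module topology); continuous because `q` is continuous for the discrete topology on `G`.
This is the passage "representations of `G(L|K)`" ⟶ "Artin representations" of Neukirch VII §10
(the tree's `ArtinRep.monomial` is the special case `τ = Ind_H^G θ`).
[cite: NeukirchANT1999, VII §10 (10.1)] -/
def inflate [Finite G] (hq : IsArtinQuotient q) {V : Type*} [AddCommGroup V] [Module ℂ V]
    [TopologicalSpace V] [IsModuleTopology ℂ V] [FiniteDimensional ℂ V]
    (τ : Representation ℂ G V) : ArtinRep F V where
  toRepresentation := τ.comp q
  continuous_smul := by
    letI : TopologicalSpace G := ⊥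
    haveI : DiscreteTopology G := ⟨rfl⟩
    haveI : ContinuousAdd V := IsModuleTopology.toContinuousAdd ℂ V
    have h1 : Continuous fun p : G × V => τ p.1 p.2 :=
      continuous_prod_of_discrete_left.mpr fun x =>
        IsModuleTopology.continuous_of_linearMap (τ x)
    exact h1.comp (hq.continuous_of_discreteTopology.prodMap continuous_id)

/-- Unfolding: `inflate hq τ γ = τ (q γ)`. [folklore] -/
theorem inflate_apply [Finite G] (hq : IsArtinQuotient q) {V : Type*} [AddCommGroup V]
    [Module ℂ V] [TopologicalSpace V] [IsModuleTopology ℂ V] [FiniteDimensional ℂ V]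
    (τ : Representation ℂ G V) (γ : Field.absoluteGaloisGroup F) : inflate hq τ γ = τ (q γ) := rfl

/-- The character of the inflation is `χ_τ ∘ q`. [folklore] -/
theorem character_inflate [Finite G] (hq : IsArtinQuotient q) {V : Type*} [AddCommGroup V]
    [Module ℂ V] [TopologicalSpace V] [IsModuleTopology ℂ V] [FiniteDimensional ℂ V]
    (τ : Representation ℂ G V) (γ : Field.absoluteGaloisGroup F) :
    (inflate hq τ).toRepresentation.character γ = τ.character (q γ) := rfl

variable [NumberField F]

/-- **Every character of `G` is realised through `q`**: for a character `φ` of `G` the function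
`φ ∘ q` on `Γ_F` is realised by an Artin representation (the inflation of a representation
affording `φ`, with the module topology). [cite: NeukirchANT1999, VII §10 (10.1)] -/
theorem exists_hasArtinRealization_comp [Finite G] (hq : IsArtinQuotient q) {φ : G → ℂ}
    (hφ : IsCharacter G φ) : ∃ L : ℂ → ℂ, HasArtinRealization (φ ∘ q) L := by
  obtain ⟨V, _, _, _, ρ, rfl⟩ := hφ
  letI : TopologicalSpace V := moduleTopology ℂ V
  haveI : IsModuleTopology ℂ V := ⟨rfl⟩
  exact ⟨_, V, _, _, inferInstance, _, inferInstance, inflate hq ρ, fun γ => rfl, fun _ _ => rfl⟩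

variable [Fintype G]

/-- **Heilbronn's generalized character** at `s₀` for the finite Galois quotient `q : Γ_F → G`
([MurtyMurty1997, Ch. 2 §5]: "`θ_G = Σ_ψ n(G, ψ) ψ`, the sum over all irreducible characters
`ψ`", with `n(G, ψ)` the order at `s₀` of the Artin `L`-series of `ψ`): the class function
`Σ_{χ irreducible} artinOrder s₀ (χ ∘ q) · χ` on `G`. [cite: MurtyMurty1997, Ch. 2 §5] -/
def heilbronnChar (q : Field.absoluteGaloisGroup F →* G) (s₀ : ℂ) : G → ℂ :=
  ∑ χ ∈ (irrChars_finite_holds G).toFinset, (artinOrder s₀ (χ ∘ q) : ℂ) • χ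

/-- Unfolding of `heilbronnChar` at a group element. [folklore] -/
theorem heilbronnChar_apply (q : Field.absoluteGaloisGroup F →* G) (s₀ : ℂ) (g : G) :
    heilbronnChar q s₀ g =
      ∑ χ ∈ (irrChars_finite_holds G).toFinset, (artinOrder s₀ (χ ∘ q) : ℂ) * χ g := by
  simp only [heilbronnChar, Finset.sum_apply, Pi.smul_apply, smul_eq_mul]

/-- The Heilbronn character is a class function. [cite: MurtyMurty1997, Ch. 2 §5] -/
theorem isClassFun_heilbronnChar (q : Field.absoluteGaloisGroup F →* G) (s₀ : ℂ) :
    IsClassFun (heilbronnChar q s₀) := by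
  intro s t
  rw [heilbronnChar_apply, heilbronnChar_apply]
  refine Finset.sum_congr rfl fun χ hχ => ?_
  rw [((irrChars_finite_holds G).mem_toFinset.mp hχ).isCharacter.isClassFun s t]

end Quotient

end Heilbronn

end Literature.NumberTheory.LFunctions

end
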